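import Summits.QuantumFields.BalabanUV.Beta.FP.TowerDoorGaugeBound
import Summits.QuantumFields.BalabanUV.Beta.FP.TowerDoorGaugeLatticeSum

/-!
# `BalabanUV.Beta.FP.TowerDoorGaugeTheta` — binder row D1, the row's ONE file, LEMMA U ⇒ `hΘ`'s ANALYTIC CORE (J-NOTE-20 §3 (d) ∕ §9 (3)):
# **EVERY `ℓ¹` PAIRING OF THE LATTICE GAUGE FUNCTION, SUMMED OVER THE SOURCES, VANISHES — `Σ'_z Σ'_u ω(u)·λℤ_(μ,z)(u) = 0`** for every absolutely summable weight `ω` and every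
# exponentially decaying chart whose `λℤ` has vanishing source sums (PART 58): the Fubini exchange `Σ_z Σ_u = Σ_u Σ_z` is licensed by PART 59's localisation `|λℤ_(μ,z)(u)| ≤ K·e^{−δ|L•z − u|₁}`
# (the double family is dominated by `|ω(u)|·K·e^{−δ|L•z−u|₁}`, summable on `ℤ⁴ × ℤ⁴`), and `Σ_z λℤ_(μ,z)(u) = 0` sitewise.  v10's `hΘ : Σ'_y τ j κ y (lam j μ 0) = 0` is this identity once the door's
# functional `τ j κ 0` is written as an `ℓ¹` pairing `v ↦ κ_τ·Σ'_u ω_{κ}(u)·v(u)` and `τ j κ y (lam j μ 0) = τ j κ 0 (lam j μ (−y))` (covariance, PART 58 `lamZ_translate`) — the door's Defs, next file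
# (β-function cell `pub-balaban`, BINDER-OWNERS row D1 ∕ (C1) OWNER «beta-an2» gen 77, PART 60; imports PART 59 + PART 58)

WHAT ([folklore] `tsum` Fubini bookkeeping BY NAME; no `def`, no `def … : Prop`, nothing cited, 0 sorry, default heartbeats).
§1 (generic `d`, kernel-generic, any `lev rs hrs`): `summable_abs_mul_lamZ_prod` (the double family `(z,u) ↦ ω u · lamZ … μ z u` is absolutely summable on `Site × Site` for `Decays A C δ`, `0 < δ`, `Σ|ω| < ∞` —
`summable_prod_of_nonneg` over PART 59 `exists_abs_lamZ_le_exp` + lit `summable_exp_shift'` ∕ `tsum_exp_shift'` along the injective source map), **`tsum_tsum_mul_lamZ_eq_zero`** (`Σ'_z Σ'_u ω u·lamZ … μ z u = 0`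
given the sitewise source sums vanish — `tsum_comm'` + `tsum_mul_left`), `tsum_tsum_lamZ_mul_eq_zero` (weights on the right).
§2 (`d = 3`) the record's chart `scaleK σ σ (AN R (n+1))`, hypothesis-free but for `Σ|ω| < ∞`: **`tsum_tsum_mul_lamZ_record_eq_zero`** (PART 59 `decays_scaleK_AN` + PART 58 `tsum_lamZ_sources_record`).
WHAT THIS IS NOT: not v10's `hΘ` letter itself (the door's `τd ∕ lamd` Defs pending); the door NOT defined; (X), (T2) NOT claimed; nothing of Bałaban's asserted, valued or discharged; 0 estimates; 0∕4 row-D1 binders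
(hW, hR, D1Tel, D1Rep); v10 NOT filed; v9 p617999 stands; NOT (C1), NOT (T-ID), NOT D1, NEVER «G-an2-4 closed», NOT BetaPertH, NOT continuum, NOT Clay.

HONEST DEPENDENCY (page 1, mandatory): continuum YM on T⁴ ⇐ BetaPertH ∧ nine spine estimates (0/9 proved); BetaPertH ⇐ (D1) ∧ (D4) ∧ CAP+tail;
G-an2-4 gates asym, D1 and NE2/3/4.  HONEST FRAMING (cell contract, verbatim): «discharging `BetaPertH` makes Bałaban's UV stability UNCONDITIONAL —
a real constructive-QFT result; it is NOT the continuum limit and NOT the Clay problem.»  ABSOLUTE RULE (cell charter, verbatim): «No internally-minted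
statement may enter as a cited fact. Every hypothesis is either kernel-proved in this package or a verbatim quotation of a PUBLISHED theorem with page
reference. The manuscript(s) under audit are NOT citable for their own disputed steps — they are the thing under adjudication; programme-internal
(2001/route/tribunal) claims are never citable.»  Row D1 ∕ (C1) OWNER «beta-an2» gen 77, 2026-08-29.  No existing file touched.
-/

noncomputable section

open Finset
open scoped BigOperators
open Literature.MathematicalPhysics.QuantumFieldTheory
open Literature.MathematicalPhysics.QuantumFieldTheory.Balaban1983to89
open Literature.MathematicalPhysics.QuantumFieldTheory.Balaban1983to89.Beta
open Literature.MathematicalPhysics.QuantumFieldTheory.Balaban1983to89.B12Sec2to5 (l1 l1_nonneg)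
open B6Lemma24Torus (pbox)
open AffineAveraging (Site toSite unitVec)
open OneStepResolventKernel (Fib)
open ExpKernelCalculus (MKer Decays Zl Zl_nonneg summable_exp_shift' tsum_exp_shift')
open HessKerRate (scaleK)
open Literature.MathematicalPhysics.QuantumFieldTheory.LatticeForm (quo)
open Summit.QuantumFields.BalabanUV.Beta.CompositeOneShotJetData (Roots AN)
open Summit.QuantumFields.BalabanUV.Beta.FP.TorusCompositeObjects (bigRatio bigRatio_pos)
open Summit.QuantumFields.BalabanUV.Beta.FP.TowerDoorGaugeRefDefs (lamZ)
open Summit.QuantumFields.BalabanUV.Beta.FP.TowerDoorGaugeBound (exists_abs_lamZ_le_exp decays_scaleK_AN)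
open Summit.QuantumFields.BalabanUV.Beta.FP.TowerDoorGaugeLatticeSum (tsum_lamZ_sources_record)

namespace Summit.QuantumFields.BalabanUV.Beta.FP.TowerDoorGaugeTheta

variable {d : ℕ}

/-! ## §1 Kernel-generic: the `ℓ¹` pairing summed over the sources -/

section Generic

variable (Lc : ℕ) [NeZero Lc] (lev : ℕ → ℕ) (rs : ℕ → (Fin (d + 1) → ℕ))
  (hrs : ∀ k i, 0 ≤ toSite (rs k) i ∧ toSite (rs k) i < (Lc : ℤ)) (n : ℕ)

/-- [folklore] **`summable_abs_mul_lamZ_prod`** — for a `δ`-decaying chart (`0 < δ`) and an absolutely summable weight `ω`, the double family `(z, u) ↦ ω u · lamZ … μ z u` is absolutely summable on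
`Site × Site` (dominated by `|ω u|·K·e^{−δ|L•z − u|₁}`; the source map `z ↦ L•z` is injective, so each `z`-fibre is a sub-series of the lattice constant `Zl δ`). -/
theorem summable_abs_mul_lamZ_prod {A : MKer (d + 1) (Fib d)} {C δ : ℝ} (hA : Decays A C δ) (hδ : 0 < δ)
    (ω : Site (d + 1) → ℝ) (hω : Summable (fun u => |ω u|)) (μ : Fin (d + 1)) :
    Summable (fun p : Site (d + 1) × Site (d + 1) => |ω p.2 * lamZ Lc lev rs hrs n A μ p.1 p.2|) := by
  obtain ⟨K, hK, h⟩ := exists_abs_lamZ_le_exp Lc lev rs hrs n hA hδ.le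
  have hL : (((bigRatio Lc (n + 1) : ℕ) : ℤ)) ≠ 0 := by exact_mod_cast (bigRatio_pos Lc (Nat.pos_of_ne_zero (NeZero.ne Lc)) (n + 1)).ne'
  have hinj : Function.Injective (fun z : Site (d + 1) => (((bigRatio Lc (n + 1) : ℕ) : ℤ)) • z) := smul_right_injective _ hL
  -- the dominating family `g (z, u) := |ω u| · (K · e^{−δ|L•z − u|₁})`, summed `u`-fibrewise over `z`
  set g : Site (d + 1) × Site (d + 1) → ℝ := fun p =>
    |ω p.2| * (K * Real.exp (-δ * l1 ((((bigRatio Lc (n + 1) : ℕ) : ℤ) • p.1) - p.2))) with hg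
  have hg0 : ∀ p, 0 ≤ g p := fun p => mul_nonneg (abs_nonneg _) (mul_nonneg hK (Real.exp_pos _).le)
  have hfib : ∀ u : Site (d + 1), Summable (fun z : Site (d + 1) => K * Real.exp (-δ * l1 ((((bigRatio Lc (n + 1) : ℕ) : ℤ) • z) - u))) :=
    fun u => ((summable_exp_shift' hδ u).comp_injective hinj).mul_left K
  have hfib_le : ∀ u : Site (d + 1), (∑' z : Site (d + 1), K * Real.exp (-δ * l1 ((((bigRatio Lc (n + 1) : ℕ) : ℤ) • z) - u))) ≤ K * Zl (d + 1) δ := by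
    intro u
    rw [tsum_mul_left]
    refine mul_le_mul_of_nonneg_left ?_ hK
    rw [← tsum_exp_shift' (c := δ) u]
    exact tsum_comp_le_tsum_of_inj (summable_exp_shift' hδ u) (fun y => (Real.exp_pos _).le) hinj
  have hgs : Summable g := by
    -- swap to the `(u, z)` order, where the fibres are the `hfib u`
    have hsw : Summable (fun p : Site (d + 1) × Site (d + 1) => g (Equiv.prodComm _ _ p)) := by
      rw [summable_prod_of_nonneg (fun p => hg0 _)]
      constructor
      · intro u
        simpa [hg] using (hfib u).mul_left (|ω u|)
      · refine Summable.of_nonneg_of_le (fun u => tsum_nonneg fun z => hg0 _) (fun u => ?_) (hω.mul_right (K * Zl (d + 1) δ))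
        simp only [hg, Equiv.prodComm_apply, Prod.swap]
        rw [tsum_mul_left]
        exact mul_le_mul_of_nonneg_left (hfib_le u) (abs_nonneg _)
    exact (Equiv.prodComm (Site (d + 1)) (Site (d + 1))).summable_iff.mp hsw
  refine Summable.of_nonneg_of_le (fun p => abs_nonneg _) (fun p => ?_) hgs
  rw [abs_mul, hg]
  exact mul_le_mul_of_nonneg_left (h μ p.1 p.2) (abs_nonneg _)

/-- [folklore] **`tsum_tsum_mul_lamZ_eq_zero` — LEMMA U's ANALYTIC CORE**: for a `δ`-decaying chart (`0 < δ`), an absolutely summable weight `ω`, and vanishing sitewise source sums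
`∀ u, Σ'_z lamZ … μ z u = 0` (PART 58), the `ℓ¹` pairing summed over the sources vanishes: `Σ'_z Σ'_u ω u · lamZ … μ z u = 0` (Fubini `tsum_comm'` over §1's domination). -/
theorem tsum_tsum_mul_lamZ_eq_zero {A : MKer (d + 1) (Fib d)} {C δ : ℝ} (hA : Decays A C δ) (hδ : 0 < δ)
    (ω : Site (d + 1) → ℝ) (hω : Summable (fun u => |ω u|)) (μ : Fin (d + 1))
    (hzero : ∀ u : Site (d + 1), (∑' z : Site (d + 1), lamZ Lc lev rs hrs n A μ z u) = 0) :
    (∑' z : Site (d + 1), ∑' u : Site (d + 1), ω u * lamZ Lc lev rs hrs n A μ z u) = 0 := by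
  have hs : Summable (fun p : Site (d + 1) × Site (d + 1) => ω p.2 * lamZ Lc lev rs hrs n A μ p.1 p.2) :=
    (summable_abs_mul_lamZ_prod Lc lev rs hrs n hA hδ ω hω μ).of_abs
  have hunc : Summable (Function.uncurry fun (z u : Site (d + 1)) => ω u * lamZ Lc lev rs hrs n A μ z u) := hs
  have h1 : ∀ z : Site (d + 1), Summable (fun u : Site (d + 1) => ω u * lamZ Lc lev rs hrs n A μ z u) := fun z => hs.prod_factor z
  have h2 : ∀ u : Site (d + 1), Summable (fun z : Site (d + 1) => ω u * lamZ Lc lev rs hrs n A μ z u) := fun u => hs.prod_symm.prod_factor u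
  calc (∑' z : Site (d + 1), ∑' u : Site (d + 1), ω u * lamZ Lc lev rs hrs n A μ z u)
      = ∑' u : Site (d + 1), ∑' z : Site (d + 1), ω u * lamZ Lc lev rs hrs n A μ z u := (hunc.tsum_comm' h1 h2).symm
    _ = ∑' u : Site (d + 1), ω u * ∑' z : Site (d + 1), lamZ Lc lev rs hrs n A μ z u := by
        refine tsum_congr fun u => ?_
        rw [tsum_mul_left]
    _ = 0 := by simp [hzero]

/-- [folklore] the same with the weight on the right: `Σ'_z Σ'_u lamZ … μ z u · ω u = 0`. -/
theorem tsum_tsum_lamZ_mul_eq_zero {A : MKer (d + 1) (Fib d)} {C δ : ℝ} (hA : Decays A C δ) (hδ : 0 < δ)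
    (ω : Site (d + 1) → ℝ) (hω : Summable (fun u => |ω u|)) (μ : Fin (d + 1))
    (hzero : ∀ u : Site (d + 1), (∑' z : Site (d + 1), lamZ Lc lev rs hrs n A μ z u) = 0) :
    (∑' z : Site (d + 1), ∑' u : Site (d + 1), lamZ Lc lev rs hrs n A μ z u * ω u) = 0 := by
  have e : ∀ z u : Site (d + 1), lamZ Lc lev rs hrs n A μ z u * ω u = ω u * lamZ Lc lev rs hrs n A μ z u := fun z u => mul_comm _ _
  simp_rw [e]
  exact tsum_tsum_mul_lamZ_eq_zero Lc lev rs hrs n hA hδ ω hω μ hzero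

end Generic

/-! ## §2 The record's chart -/

section Record

variable {Lc : ℕ} [NeZero Lc] (R : Roots Lc) (lev : ℕ → ℕ) (rs : ℕ → (Fin (3 + 1) → ℕ))
  (hrs : ∀ k i, 0 ≤ toSite (rs k) i ∧ toSite (rs k) i < (Lc : ℤ)) (n : ℕ) (σ : Fib 3 → ℝ)

/-- [folklore] **`tsum_tsum_mul_lamZ_record_eq_zero` — FOR THE RECORD's CHART, EVERY `ℓ¹` PAIRING OF `λℤ` SUMMED OVER THE SOURCES VANISHES**:
`Σ'_z Σ'_u ω u · lamZ Lc lev rs hrs n (scaleK σ σ (AN R (n+1))) μ z u = 0` for every absolutely summable `ω` (PART 59 `decays_scaleK_AN`, PART 58 `tsum_lamZ_sources_record`). -/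
theorem tsum_tsum_mul_lamZ_record_eq_zero (ω : Site (3 + 1) → ℝ) (hω : Summable (fun u => |ω u|)) (μ : Fin (3 + 1)) :
    (∑' z : Site (3 + 1), ∑' u : Site (3 + 1), ω u * lamZ Lc lev rs hrs n (scaleK σ σ (AN R (n + 1))) μ z u) = 0 := by
  obtain ⟨δ, C, hδ, _, hA⟩ := decays_scaleK_AN R σ (n + 1)
  exact tsum_tsum_mul_lamZ_eq_zero Lc lev rs hrs n hA hδ ω hω μ (fun u => tsum_lamZ_sources_record R lev rs hrs n σ μ u)

/-- [folklore] the double family is absolutely summable for the record's chart (for the door's later Fubini steps). -/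
theorem summable_abs_mul_lamZ_record_prod (ω : Site (3 + 1) → ℝ) (hω : Summable (fun u => |ω u|)) (μ : Fin (3 + 1)) :
    Summable (fun p : Site (3 + 1) × Site (3 + 1) => |ω p.2 * lamZ Lc lev rs hrs n (scaleK σ σ (AN R (n + 1))) μ p.1 p.2|) := by
  obtain ⟨δ, C, hδ, _, hA⟩ := decays_scaleK_AN R σ (n + 1)
  exact summable_abs_mul_lamZ_prod Lc lev rs hrs n hA hδ ω hω μ

end Record

end Summit.QuantumFields.BalabanUV.Beta.FP.TowerDoorGaugeTheta

end
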